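import Summits.AnomalousDissipation.AnomalousDissipation.Theses.LandauJetArena
import Literature.Analysis.FunctionSpaces.TorusTrigPoly
import Literature.Analysis.FluidPDE.DoeringFoias
import Literature.Analysis.FluidPDE.LongTimeAverageNonneg

/-!
# Birth skeleton of the ∀-piece `JetPairWorkFloor` — line `cascade-floor` (crux-strategist, stmt-AnomalousDissipation-1540)

The ∀-piece of the split of `LandauJetArena.JetPairZerothLaw` (input-power floor at zero momentum,
body verbatim as filed in `children.json`; after `route edit --split` it is the route decl
`…Theses.LandauJetArena.JetPairWorkFloor` and `JetPairWorkFloor_of` re-points by name).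

LINE (forward-cascade reformulation). For a global Leray–Hopf solution the energy held by the Fourier
modes `|k| ≤ N` obeys the LOW-MODE BALANCE (test the time-sliced weak formulation with the finitely many
modes of `P_N u`, `P_N = Torus.fourierTruncate N`):
`d/dt ½‖P_N u‖² = −F_N(u) − ν‖∇P_N u‖² + ∫⟪f, P_N u⟫`, where
`F_N(v) := −∫ ⟪v, (v·∇) P_N v⟫` is the FORWARD ENERGY FLUX through wavenumber `N`.
Averaging in time (energies are bounded) gives `⟨∫⟪f, P_N u⟫⟩ ≥ ⟨F_N⟩`, and `⟨f, P_N u⟩ = ⟨f, u⟩ − ⟨f − P_N f, u⟩`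
with `‖f − P_N f‖₂ → 0` (`f` smooth). Hence an input-power floor follows from a FLUX FLOOR at one
sufficiently large wavenumber: the cascade statement of Kolmogorov's theory, which is the honest content
of the piece (and, as `ν → 0` at fixed `N`, equivalent to it: `⟨F_N⟩ ≥ ⟨f·u⟩ − νN²E − tail`).

Stubs: `stub_fluxFloor` (HARDEST — the cascade floor, uniform over zero-momentum bounded solutions),
`stub_lowModeBalance` (provable now, L: time-sliced weak formulation mode by mode + AC product rule +
limsup bookkeeping), `stub_forceTailVanishes` (provable now, M: Parseval tail of a smooth field).
Composition `JetPairWorkFloor_of` is real (case `E < 0` vacuous by `meanEnergy_nonneg`; choose `N`, then `ν₀(N)`;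
`ε := ε′/2`).
-/

namespace Summit.AnomalousDissipation.AnomalousDissipation.Cruxes.JetPairZerothLaw.CascadeFloor

set_option linter.dupNamespace false

open Filter Topology MeasureTheory
open scoped InnerProductSpace
open Literature.Analysis.FunctionSpaces Literature.Analysis.FluidPDE

/-- The ∀-piece, verbatim (child 1 of the split of `JetPairZerothLaw`). -/
def JetPairWorkFloor : Prop :=
  ∀ (ρ : ℝ) (a : UnitAddTorus (Fin 3)) (φ : UnitAddTorus (Fin 3) → ℝ) (f : UnitAddTorus (Fin 3) → EuclideanSpace ℝ (Fin 3)), (0 < ρ ∧ 4 * ρ < ‖a + a‖ ∧ Literature.Analysis.FunctionSpaces.Torus.IsSmooth φ ∧ (∀ x, 0 ≤ φ x) ∧ (∀ x : UnitAddTorus (Fin 3), ρ ≤ ‖x‖ → φ x = 0) ∧ MeasureTheory.integral MeasureTheory.volume (fun x => φ x) = 1 ∧ Literature.Analysis.FunctionSpaces.Torus.IsSmooth f ∧ Literature.Analysis.FunctionSpaces.Torus.IsDivFree f ∧ Literature.Analysis.FunctionSpaces.Torus.HasZeroMean f ∧ (∀ w : UnitAddTorus (Fin 3) → EuclideanSpace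 ℝ (Fin 3), Literature.Analysis.FunctionSpaces.Torus.IsSmooth w → Literature.Analysis.FunctionSpaces.Torus.IsDivFree w → MeasureTheory.integral MeasureTheory.volume (fun x => inner ℝ (f x) (w x)) = MeasureTheory.integral MeasureTheory.volume (fun x => (φ (x - a) - φ (x + a)) * inner ℝ (w x) (EuclideanSpace.single (2 : Fin 3) (1 : ℝ) : EuclideanSpace ℝ (Fin 3))))) → ∀ E : ℝ, ∃ ε : ℝ, 0 < ε ∧ ∃ ν₀ : ℝ, 0 < ν₀ ∧ ∀ (ν : ℝ) (u₀ : UnitAddTorus (Fin 3) → EuclideanSpace ℝ (Fin 3)) (u : ℝ → UnitAddTorus (Fin 3) → EuclideanSpace ℝ (Fin 3)), 0 < ν → ν ≤ ν₀ → Literature.Analysis.FunctionSpaces.Torus.HasZeroMean u₀ → Literature.Analysis.FluidPDE.Torus.IsGlobalLerayHopf ν (fun _ => f) u₀ u → Literature.Analysis.FluidPDE.meanEnergy u ≤ E → ε ≤ Literature.Analysis.FluidPDE.longTimeAvgSup (fun t => MeasureTheory.integral MeasureTheory.volume (fun x => inner ℝ (f x) (u t x)))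

/-- Forward energy flux through wavenumber `N` of a velocity field:
`F_N(v) = −∫ ⟪v, (v·∇)(P_N v)⟫` (`P_N = Torus.fourierTruncate N`; for smooth divergence-free `v`
this is `∫ ⟪(v·∇)v, P_N v⟫`, the nonlinear transfer out of the modes `|k| ≤ N`; Frisch 1995 §6.2.2 `Π_K`). -/
noncomputable def fluxThrough (N : ℕ) (v : UnitAddTorus (Fin 3) → EuclideanSpace ℝ (Fin 3)) : ℝ :=
  - ∫ x, ⟪v x, Torus.convect v (Torus.fourierTruncate N v) x⟫_ℝ

/-- `L²` size of the spectral tail of the force beyond wavenumber `N`. -/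
noncomputable def forceTail (N : ℕ) (f : UnitAddTorus (Fin 3) → EuclideanSpace ℝ (Fin 3)) : ℝ :=
  Real.sqrt (∫ x, ‖f x - Torus.fourierTruncate N f x‖ ^ 2)

/-- **stub (HARDEST): the cascade floor.** For every jet-pair force and every energy level there are
`ε′ > 0` and `N₀` such that for every wavenumber `N ≥ N₀`, once `ν ≤ ν₀(N)`, EVERY global Leray–Hopf solution
with zero-momentum datum and limsup-mean energy `≤ E` has limsup-mean forward flux through `N` at least `ε′`
(order `∀ N ≥ N₀, ∃ ν₀(N)`: the inertial range passes any fixed `N` as `ν → 0`). Kolmogorov's constant-flux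
picture for the jet pair; no bounded zero-momentum state may absorb the push without cascading. -/
theorem stub_fluxFloor :
    ∀ (ρ : ℝ) (a : UnitAddTorus (Fin 3)) (φ : UnitAddTorus (Fin 3) → ℝ) (f : UnitAddTorus (Fin 3) → EuclideanSpace ℝ (Fin 3)), (0 < ρ ∧ 4 * ρ < ‖a + a‖ ∧ Literature.Analysis.FunctionSpaces.Torus.IsSmooth φ ∧ (∀ x, 0 ≤ φ x) ∧ (∀ x : UnitAddTorus (Fin 3), ρ ≤ ‖x‖ → φ x = 0) ∧ MeasureTheory.integral MeasureTheory.volume (fun x => φ x) = 1 ∧ Literature.Analysis.FunctionSpaces.Torus.IsSmooth f ∧ Literature.Analysis.FunctionSpaces.Torus.IsDivFree f ∧ Literature.Analysis.FunctionSpaces.Torus.HasZeroMean f ∧ (∀ w : UnitAddTorus (Fin 3) → EuclideanSpace ℝ (Fin 3), Literature.Analysis.FunctionSpaces.Torus.IsSmooth w → Literature.Analysis.FunctionSpaces.Torus.IsDivFree w → MeasureTheory.integral MeasureTheory.volume (fun x => inner ℝ (f x) (w x)) = MeasureTheory.integral MeasureTheory.volume (fun x => (φ (x - a) - φ (x + a))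 * inner ℝ (w x) (EuclideanSpace.single (2 : Fin 3) (1 : ℝ) : EuclideanSpace ℝ (Fin 3))))) → ∀ E : ℝ, ∃ ε' : ℝ, 0 < ε' ∧ ∃ N₀ : ℕ, ∀ N : ℕ, N₀ ≤ N → ∃ ν₀ : ℝ, 0 < ν₀ ∧
      ∀ (ν : ℝ) (u₀ : UnitAddTorus (Fin 3) → EuclideanSpace ℝ (Fin 3)) (u : ℝ → UnitAddTorus (Fin 3) → EuclideanSpace ℝ (Fin 3)), 0 < ν → ν ≤ ν₀ →
        Torus.HasZeroMean u₀ → Torus.IsGlobalLerayHopf ν (fun _ => f) u₀ u → meanEnergy u ≤ E →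
          ε' ≤ longTimeAvgSup (fun t => fluxThrough N (u t)) := by
  sorry

/-- **stub: the low-mode balance** (provable now). For a global Leray–Hopf solution driven by a smooth
divergence-free mean-zero steady force with limsup-mean energy `≤ E` (`0 ≤ E`), the limsup-mean forward
flux through any wavenumber `N` is at most the limsup-mean input power plus the tail error
`‖f − P_N f‖₂ √E`: time-average `d/dt ½‖P_N u‖² = −F_N − ν‖∇P_N u‖² + ⟨f, P_N u⟩` (the mode-wise
time-sliced weak formulation, `Torus.IsLerayHopfOn.integral_inner_eq_add_setIntegral`, summed over
`|k| ≤ N`), drop `ν‖∇P_N u‖² ≥ 0`, and bound `|⟨f − P_N f, u⟩| ≤ ‖f − P_N f‖₂‖u‖₂` with Jensen in time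
(as in `Torus.IsGlobalLerayHopf.meanPower_le`). -/
theorem stub_lowModeBalance :
    ∀ (ν : ℝ) (N : ℕ) (f : UnitAddTorus (Fin 3) → EuclideanSpace ℝ (Fin 3)) (u₀ : UnitAddTorus (Fin 3) → EuclideanSpace ℝ (Fin 3)) (u : ℝ → UnitAddTorus (Fin 3) → EuclideanSpace ℝ (Fin 3)) (E : ℝ),
      0 < ν → Torus.IsSmooth f → Torus.IsDivFree f → Torus.HasZeroMean f →
        Torus.IsGlobalLerayHopf ν (fun _ => f) u₀ u → 0 ≤ E → meanEnergy u ≤ E →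
          longTimeAvgSup (fun t => fluxThrough N (u t)) ≤ meanPower f u + forceTail N f * Real.sqrt E := by
  sorry

/-- **stub: the spectral tail of a smooth force vanishes** (provable now): `‖f − P_N f‖₂ → 0` as
`N → ∞` for smooth `f` (Parseval, `Torus.mFourierCoeff_fourierTruncate`, summable `∑‖f̂ k‖²`). -/
theorem stub_forceTailVanishes :
    ∀ f : UnitAddTorus (Fin 3) → EuclideanSpace ℝ (Fin 3), Torus.IsSmooth f → Tendsto (fun N => forceTail N f) atTop (𝓝 0) := by
  sorry

/-- **Composition (kernel-checked, no sorry): the three stubs give the ∀-piece.** Given a jet-pair force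
and `E`: if `E < 0` no solution has `meanEnergy ≤ E` (`meanEnergy_nonneg`) and any `ε` works; otherwise take
`ε′, N₀` from the cascade floor, `N ≥ N₀` with `forceTail N f · √E ≤ ε′/2` from the vanishing tail, then
`ν₀(N)`; for an admissible solution `ε′ ≤ ⟨F_N⟩ ≤ ⟨f·u⟩ + ε′/2`, so `ε := ε′/2` is an input-power floor. -/
theorem JetPairWorkFloor_of
    (hFlux : ∀ (ρ : ℝ) (a : UnitAddTorus (Fin 3)) (φ : UnitAddTorus (Fin 3) → ℝ) (f : UnitAddTorus (Fin 3) → EuclideanSpace ℝ (Fin 3)), (0 < ρ ∧ 4 * ρ < ‖a + a‖ ∧ Literature.Analysis.FunctionSpaces.Torus.IsSmooth φ ∧ (∀ x, 0 ≤ φ x) ∧ (∀ x : UnitAddTorus (Fin 3), ρ ≤ ‖x‖ → φ x = 0) ∧ MeasureTheory.integral MeasureTheory.volume (fun x => φ x) = 1 ∧ Literature.Analysis.FunctionSpaces.Torus.IsSmooth f ∧ Literature.Analysis.FunctionSpaces.Torus.IsDivFree f ∧ Literature.Analysis.FunctionSpaces.Torus.HasZeroMean f ∧ (∀ w : UnitAddTorus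 (Fin 3) → EuclideanSpace ℝ (Fin 3), Literature.Analysis.FunctionSpaces.Torus.IsSmooth w → Literature.Analysis.FunctionSpaces.Torus.IsDivFree w → MeasureTheory.integral MeasureTheory.volume (fun x => inner ℝ (f x) (w x)) = MeasureTheory.integral MeasureTheory.volume (fun x => (φ (x - a) - φ (x + a)) * inner ℝ (w x) (EuclideanSpace.single (2 : Fin 3) (1 : ℝ) : EuclideanSpace ℝ (Fin 3))))) → ∀ E : ℝ, ∃ ε' : ℝ, 0 < ε' ∧ ∃ N₀ : ℕ, ∀ N : ℕ, N₀ ≤ N → ∃ ν₀ : ℝ, 0 < ν₀ ∧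
      ∀ (ν : ℝ) (u₀ : UnitAddTorus (Fin 3) → EuclideanSpace ℝ (Fin 3)) (u : ℝ → UnitAddTorus (Fin 3) → EuclideanSpace ℝ (Fin 3)), 0 < ν → ν ≤ ν₀ →
        Torus.HasZeroMean u₀ → Torus.IsGlobalLerayHopf ν (fun _ => f) u₀ u → meanEnergy u ≤ E →
          ε' ≤ longTimeAvgSup (fun t => fluxThrough N (u t)))
    (hBal : ∀ (ν : ℝ) (N : ℕ) (f : UnitAddTorus (Fin 3) → EuclideanSpace ℝ (Fin 3)) (u₀ : UnitAddTorus (Fin 3) → EuclideanSpace ℝ (Fin 3)) (u : ℝ → UnitAddTorus (Fin 3) → EuclideanSpace ℝ (Fin 3)) (E : ℝ),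
      0 < ν → Torus.IsSmooth f → Torus.IsDivFree f → Torus.HasZeroMean f →
        Torus.IsGlobalLerayHopf ν (fun _ => f) u₀ u → 0 ≤ E → meanEnergy u ≤ E →
          longTimeAvgSup (fun t => fluxThrough N (u t)) ≤ meanPower f u + forceTail N f * Real.sqrt E)
    (hTail : ∀ f : UnitAddTorus (Fin 3) → EuclideanSpace ℝ (Fin 3), Torus.IsSmooth f → Tendsto (fun N => forceTail N f) atTop (𝓝 0)) :
    JetPairWorkFloor := by
  intro ρ a φ f hcfg E
  have hcfg' := hcfg
  obtain ⟨-, -, -, -, -, -, hfs, hfd, hfm, -⟩ := hcfg'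
  by_cases hE : E < 0
  · -- vacuous level: no solution has negative mean energy
    refine ⟨1, one_pos, 1, one_pos, fun ν u₀ u _ _ _ _ hEle => ?_⟩
    exact absurd (lt_of_le_of_lt ((meanEnergy_nonneg u).trans hEle) hE) (lt_irrefl _)
  replace hE : 0 ≤ E := le_of_not_gt hE
  obtain ⟨ε', hε', N₀, hN⟩ := hFlux ρ a φ f hcfg E
  -- choose N ≥ N₀ with a small force tail
  have hsmall : ∀ᶠ N in atTop, forceTail N f * Real.sqrt E ≤ ε' / 2 := by
    have h1 : Tendsto (fun N => forceTail N f * Real.sqrt E) atTop (𝓝 (0 * Real.sqrt E)) :=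
      (hTail f hfs).mul_const _
    rw [zero_mul] at h1
    exact (h1.eventually (Iic_mem_nhds (half_pos hε'))).mono fun N hN => hN
  obtain ⟨N, hN₀N, hNtail⟩ := (((eventually_ge_atTop N₀).and hsmall)).exists
  obtain ⟨ν₀, hν₀, hfl⟩ := hN N hN₀N
  refine ⟨ε' / 2, half_pos hε', ν₀, hν₀, fun ν u₀ u hν hνle hzm hLH hEle => ?_⟩
  have h1 : ε' ≤ longTimeAvgSup (fun t => fluxThrough N (u t)) := hfl ν u₀ u hν hνle hzm hLH hEle
  have h2 : longTimeAvgSup (fun t => fluxThrough N (u t)) ≤ meanPower f u + forceTail N f * Real.sqrt E :=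
    hBal ν N f u₀ u E hν hfs hfd hfm hLH hE hEle
  show ε' / 2 ≤ meanPower f u
  linarith

/-- The registered stubs compose to the piece. -/
theorem JetPairWorkFloor_holds_of_stubs : JetPairWorkFloor :=
  JetPairWorkFloor_of stub_fluxFloor stub_lowModeBalance stub_forceTailVanishes

end Summit.AnomalousDissipation.AnomalousDissipation.Cruxes.JetPairZerothLaw.CascadeFloor
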